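import Literature.NumberTheory.Automorphic.HilbertRepSpectrum
import Mathlib.Analysis.InnerProductSpace.Projection.Submodule
import HarnessLib

/-!
# Crux `H413`, line `F0_U3CohMultOne` — generic Hilbert-space lemmas for the spectral junction: irreducible summands meet every
# non-zero vector; orthogonal projections onto closed invariant subspaces are equivariant

Floor-0 programme P3 «U3-mult», seat F0P3-p02 (g0); crux item stmt-HodgeConjecture-24833 (`HCCMUnconditional.H413`).
HC_CM is proved only modulo the printed citations until rung 0 closes.

Generic over a UNITARY continuous representation `π` of a group `G` on a complex Hilbert space `H` (★ `HilbertRepSpectrum`: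
`ClosedSubrep`, `IsTopIrreducible`, `discretePart`, `IsDiscretelyDecomposable`, `IsUnitary`, `ClosedSubrep.orthogonal`), for the crux's `L²(U(V)(F⁺)\U(V)(𝔸_{F⁺}))` (`AdelicGroupData.rightRegular`, unitary and — compact quotient —
discretely decomposable):
* `exists_irreducible_not_orthogonal` — in a DISCRETELY DECOMPOSABLE `π` (`discretePart = ⊤`) every non-zero vector is not orthogonal to
  some irreducible closed invariant subspace (else it is orthogonal to their dense span);
* `orthogonalProjectionOnto_map` — the orthogonal projection onto a closed invariant subspace commutes with `π g` (`W` and `Wᗮ` are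
  invariant), `orthogonalProjectionOnto_ne_zero`;
(Orthogonality of DISTINCT irreducibles under multiplicity one — the E1 input of the S3/S4 folds — is ★
`Theorems/H413SpectrumOrthogonality.lean` :: `SpectrumJunction.isOrtho_of_ne` (F0P3-p04), not repeated here.)

References: [Dixmier1977] J. Dixmier, *C*-algebras* (1977) §5.4, §13.1; [DeitmarEchterhoff2014] A. Deitmar, S. Echterhoff, *Principles of
Harmonic Analysis* (2014) Cor. 6.1.9, Thm. 9.2.2; [BorelJacquet1979] Corvallis PSPM 33.1 §4.6 (projections of `L²_d` commute with `G(𝔸)`).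
-/

-- the mandated namespace repeats `HodgeConjecture.HodgeConjecture`, as in every `Theorems/*.lean` of this sub-problem
set_option linter.dupNamespace false

noncomputable section

open scoped InnerProductSpace

namespace Summit.HodgeConjecture.HodgeConjecture.Cruxes.H413.F0P3HilbertProjection

section Hilbert

variable {G H : Type*} [Group G] [NormedAddCommGroup H] [InnerProductSpace ℂ H] [CompleteSpace H]
  {π : ContRepresentation ℂ G H}

/-- **In a discretely decomposable representation every non-zero vector is not orthogonal to some irreducible closed invariant
subspace** (else it is orthogonal to their closed span, which is everything). [cite: Dixmier1977, §13.1] -/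
theorem exists_irreducible_not_orthogonal (hπ : π.IsDiscretelyDecomposable) {v : H} (hv : v ≠ 0) :
    ∃ W : ContRepresentation.ClosedSubrep π, W.toContRep.IsTopIrreducible ∧ ∃ u ∈ W, ⟪u, v⟫_ℂ ≠ 0 := by
  by_contra hcon
  push Not at hcon
  apply hv
  -- `v` is orthogonal to the span of the irreducible closed subrepresentations
  set S : Set (ContRepresentation.ClosedSubrep π) := {W | W.toContRep.IsTopIrreducible} with hS
  set M : Submodule ℂ H := ⨆ W ∈ S, (W : ContRepresentation.ClosedSubrep π).toSubmodule with hM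
  have hle : M ≤ (ℂ ∙ v)ᗮ :=
    iSup₂_le fun W hW u hu => (Submodule.mem_orthogonal_singleton_iff_inner_left).mpr (hcon W hW u hu)
  have hvM : v ∈ Mᗮ :=
    Submodule.orthogonal_le hle (Submodule.le_orthogonal_orthogonal _ (Submodule.mem_span_singleton_self v))
  -- and that span is dense
  have hdense : M.topologicalClosure = ⊤ := by
    have h1 : (π.discretePart).toSubmodule = (⊤ : ContRepresentation.ClosedSubrep π).toSubmodule := by
      rw [show π.discretePart = ⊤ from hπ]
    exact h1
  rw [Submodule.topologicalClosure_eq_top_iff] at hdense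
  rw [hdense] at hvM
  exact (Submodule.mem_bot ℂ).mp hvM

/-- **The orthogonal projection onto a closed invariant subspace of a UNITARY representation commutes with the group**:
`pr_W (π g v) = π g (pr_W v)` (both `W` and `Wᗮ` are invariant). [cite: Dixmier1977, §13.1] [cite: BorelJacquet1979, §4.6] -/
theorem orthogonalProjectionOnto_map (hπ : π.IsUnitary) (W : ContRepresentation.ClosedSubrep π) (g : G) (v : H) :
    (W.toSubmodule.orthogonalProjectionOnto (π g v) : H) = π g (W.toSubmodule.orthogonalProjectionOnto v : H) := by
  rw [← Submodule.starProjection_apply, ← Submodule.starProjection_apply]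
  apply Submodule.eq_starProjection_of_mem_orthogonal
  · exact W.apply_mem g (Submodule.starProjection_apply_mem _ v)
  · rw [← map_sub]
    exact (W.orthogonal hπ).apply_mem g (Submodule.sub_starProjection_mem_orthogonal v)

/-- The projection onto `W` of a vector not orthogonal to `W` is non-zero. [folklore] -/
theorem orthogonalProjectionOnto_ne_zero (W : ContRepresentation.ClosedSubrep π) {v : H}
    (hv : ∃ u ∈ W, ⟪u, v⟫_ℂ ≠ 0) : W.toSubmodule.orthogonalProjectionOnto v ≠ 0 := by
  obtain ⟨u, hu, huv⟩ := hv
  intro h0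
  rw [Submodule.orthogonalProjectionOnto_eq_zero_iff, Submodule.mem_orthogonal] at h0
  exact huv (h0 u hu)


end Hilbert


end Summit.HodgeConjecture.HodgeConjecture.Cruxes.H413.F0P3HilbertProjection

end
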